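import Summits.BirchSwinnertonDyer.BirchSwinnertonDyer.Theorems.SchneiderFreeAdditiveX3BranchBDPDisplayOfLZZ
import Summits.BirchSwinnertonDyer.BirchSwinnertonDyer.Theorems.SchneiderFreeAdditiveX3Defs
import Summits.BirchSwinnertonDyer.Rank1Residual.X11b.IntSeriesValueRigidityOneSided
import Summits.BirchSwinnertonDyer.Rank1Residual.X11b.RouteR1LogOmega
import Summits.BirchSwinnertonDyer.Rank1Residual.X11b.RouteR1IntReceptacle
import Summits.BirchSwinnertonDyer.Rank1Residual.X11b.UnrIntegersValuationRing
import Summits.BirchSwinnertonDyer.Rank1Residual.X11b.PadicComplexInertiaFixed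
import Summits.BirchSwinnertonDyer.Rank1Residual.Partition.AnticyclotomicControlJSWEmbAt
import Summits.BirchSwinnertonDyer.Rank1Residual.Additive.N10LowerHalfStatements
import Literature.NumberTheory.EllipticCurves.ModularCurveManinConstantProofs
import Literature.NumberTheory.EllipticCurves.ManinConstantQuadraticTwistClassCertificate
import HarnessLib

/-!
# K1's analytic half H2 `SchneiderFree.BranchBDPValueLeAt W p` IS A THEOREM modulo ONE refereed input (Liu–Zhang–Zhang
# 2018 Thm 1.5.1/1.5.3 at `p² ∣ N`): at EVERY odd additive prime `p` of EVERY `W/ℚ` (the whole N10 locus and beyond), for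
# EVERY Heegner field with `Odd d_K`, `p ∤ #𝓞_K^×`, EVERY frame `(κ, γ, 𝔭, ι′)` and EVERY `R₀`-frame `L` of `Dt.f`:
# `L(𝟙) = u·(log_{ω_E} P / c)²` with `u ∈ R₀ˣ` (the socket asks only `u ∈ R₀`)

Prover seat `bsd-potss-kmc` (g19), cell `bsd-potss`, 2026-08-27; offered to route `SchneiderFreeAdditiveX3` (K1, cell
`bsd-schneider`; cruxes 19176 `PotMultBranchIMC` / 19177 `GordTwoBranchIMC`, door
`additiveX3RankOneLower_of_printedFacts_of_pt_of_typedHalves` with typed halves H1/H2/H3 on the two cells). HONEST FRAMING: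
THEOREMS ONLY (0 definitions, 0 named facts, 0 `sorry`), CONDITIONAL on the refereed input
`hL : LiuZhangZhang2018.thm151_thm153_modularCurve_heegnerVector_additive` (statement-only named fact p518041). With this
file the binders `hM2`/`hG2` (H2 on the (M) and (G-ord, e = 2) cells) of the K1 door are discharged by
`fun W _ _ p _ _ _ _ _ => branchBDPValueLeAt_of_lzz hL W p`; H1 (an `R₀`-frame EXISTS) and H3 (the divisibility) stay typed.
BSD_p is proved for no curve by any of this.

* §1 **`intSeries_value_of_frame_tors`** — every ♭-frame `Q′ ∈ 𝓞_{ℂ_p}⟦T⟧` of any newform of `W` at `(ι′, 𝔭)` has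
  `Q′(𝟙) = u·(log_ω P/c)²`, `‖u‖ = 1` (odd `p`, `p² ∣ N`, `p ∤ w_K`, Heegner `K`, `P` the datum's Heegner point, non-torsion):
  the continuous display of part 1 (`exists_continuousDisplay_tors`) transferred by X11b's one-sided rigidity.
* §2 **`unrSeries_value_of_frame_tors`** — every `R₀`-frame `L` (`IsBDPLFunction`): `L(𝟙) = u·(log_ω P/c)²` with `u ∈ R₀ˣ`
  (read `L` in `𝓞_{ℂ_p}⟦T⟧`, §1, then `[T⁰]L/(log_ω P/c)² ∈ Frac R₀` of norm one lies in `R₀` — `R1.mem_unrIntegers_of_mem_fracUnr`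
  — and is a unit — `unrIntegers.isUnit_iff_norm_eq_one`).
* §3 **`branchBDPValueLeAt_of_lzz (hL) (W) (p) : SchneiderFree.BranchBDPValueLeAt W p`** — H2 VERBATIM (its binders give
  `p ≠ 2` and `Addv W p` through `Additive.N10.Locus`, hence `p² ∣ N`; `Odd d_K` is not even used).

What this is NOT: not H1 (`BranchBDPExistsAt`: an `R₀`-valued frame at `p² ∣ N` is not in print), not H3, not a Literature filing;
nothing booked. References: [LiuZhangZhang2018] Thm 1.5.1/1.5.3; [Castella2018] Thms. 3.1–3.2 (shapes); [SerreLocalFields1979]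
Ch. II §5 (`R₀` a valuation ring); [JetchevSkinnerWan2017] §7.4.1 (the Manin slack).
-/

set_option autoImplicit false

-- D-0017 layout: summit = sub-problem, so `Summit.BirchSwinnertonDyer.BirchSwinnertonDyer.…` is the
-- mandated namespace of Theorems files (same option as the route's sibling Theorems files).
set_option linter.dupNamespace false

noncomputable section

open scoped Classical Topology NumberField

namespace Summit.BirchSwinnertonDyer.BirchSwinnertonDyer.Theorems.UniversalToricDescentWaldspurgerFlat

open Filter WeierstrassCurve NumberField IsDedekindDomain Field PowerSeries
  Literature.NumberTheory.EllipticCurves Literature.NumberTheory.EllipticCurves.ModularForms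
  Literature.NumberTheory.EllipticCurves.LiuZhangZhang2018 Literature.NumberTheory.EllipticCurves.Rank1Residual
  Literature.NumberTheory.GaloisRepresentations
  Summit.BirchSwinnertonDyer.Rank1Residual Summit.BirchSwinnertonDyer.Rank1Residual.X11b
  Summit.BirchSwinnertonDyer.Rank1Residual.X11b.Halves

/-! ### §1 Every ♭-frame (any odd additive prime, `p ∤ w_K`) -/

section Flat

variable {p : ℕ} [Fact p.Prime]

/-- **The value at `𝟙` of every ♭-frame at an additive prime, Manin constant kept, `p ∤ w_K`.** For `W/ℚ` globally
minimal with bad ADDITIVE reduction at the odd prime `p` (`p² ∣ N_W`), `K` imaginary quadratic with `p ∤ #𝓞_K^×` satisfying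
the Heegner hypothesis for `N_W` (sibling of `intSeries_value_of_frame_manin`, whose binder is `d_K < −4`), a Heegner datum `(Dt, H, ι_K, P)` with `P` of INFINITE order, `(κ, γ)`
anticyclotomic, a degree-one prime `𝔭 ∋ p`, an embedding datum `ι′` inducing `𝔭` and ANY form `f` that is a newform
of `W`: EVERY ♭-frame `(Ω_K′ ≠ 0, Ω_p′ ≠ 0, Q′ ∈ 𝓞_{ℂ_p}⟦T⟧)` with `R1.IsBDPLFunctionInt p ι′ 𝔭 κ γ f Ω_K′ Ω_p′ Q′`
has `Q′(𝟙) = u·(log_{ω_E} P / c)²` with `‖u‖ = 1` (`log` at `embAt K p 𝔭`) — the continuous display of §1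
transferred by X11b's one-sided rigidity (`X11b.intSeries_constantCoeff_eq_of_isBDPLFunctionInt_of_continuousValues`).
CONDITIONAL on the LZZ input `hL`; no `R₀`, CM, image or rank hypothesis.
[cite: LiuZhangZhang2018, Thm 1.5.1 and Thm 1.5.3 (Duke Math. J. 167 pp. 748–749)]
[cite: Castella2018, Thm. 3.1–3.2 (arXiv:1704.06608 pp. 8–9) (shapes)] -/
theorem intSeries_value_of_frame_tors
    (hL : thm151_thm153_modularCurve_heegnerVector_additive)
    (W : WeierstrassCurve ℚ) [W.IsElliptic] [W.IsGloballyMinimal]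
    (K : Type) [Field K] [NumberField K] (𝔭 : HeightOneSpectrum (𝓞 K))
    (κ : ZpExtension K p) (γ : absoluteGaloisGroup K) [Fact (κ.IsTopGenerator γ)] {N : ℕ} [NeZero N]
    (Dt : ModularParametrizationData W N) (H : HeegnerDatum N (NumberField.discr K))
    (ιK : K →+* ℂ) (P : (W.baseChange K).toAffine.Point)
    (f : CuspForm (CongruenceSubgroup.Gamma0 N) 2) (hfW : IsNewformOf W f)
    (hp2 : p ≠ 2) (hN : W.conductorNorm ℤ = N) (hp2N : p ^ 2 ∣ N) (hK : IsImaginaryQuadratic K)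
    (hpw : ¬ p ∣ NumberField.Units.torsionOrder K)
    (h𝔭 : ((p : ℕ) : 𝓞 K) ∈ 𝔭.asIdeal) (he : 𝔭.asIdeal.ramificationIdx (𝓞 ℚ) = 1)
    (hf : 𝔭.asIdeal.inertiaDeg (𝓞 ℚ) = 1)
    (hHN : SatisfiesHeegnerHypothesis N K) (hκ : κ.IsAnticyclotomic)
    (hP : WeierstrassCurve.Affine.Point.map ιK.toRatAlgHom P = heegnerPointComplex Dt H)
    (hPinf : ¬ IsOfFinAddOrder P)
    (ι' : PadicAlgCl p ≃+* ℂ)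
    (hι' : ∀ (w : InfinitePlace K) (k : 𝓞 K), k ∈ 𝔭.asIdeal ↔ ‖ι'.symm (w.embedding (k : K))‖ < 1)
    {ΩK' : ℂ} {Ωp' : ℂ_[p]} {Q' : PowerSeries (PadicComplexInt p)} (hΩK' : ΩK' ≠ 0) (hΩp' : Ωp' ≠ 0)
    (hQ' : R1.IsBDPLFunctionInt p ι' 𝔭 κ γ f ΩK' Ωp' Q') :
    ∃ u : ℂ_[p], ‖u‖ = 1 ∧ IntSeries.HasValueAt Q' 0
      (u * (algebraMap ℚ_[p] ℂ_[p] (logOmega W p (embAt K p 𝔭 h𝔭 he hf) P / (Dt.c : ℚ_[p]))) ^ 2) := by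
  have hp : p.Prime := Fact.out
  have hγ : κ.IsTopGenerator γ := Fact.out
  have hpN : p ∣ N := dvd_trans (dvd_pow_self p two_ne_zero) hp2N
  have hsplit : ((Ideal.span {(p : ℤ)}).primesOver (𝓞 K)).ncard = 2 := hHN p hp hpN
  set e : K →+* ℚ_[p] := embAt K p 𝔭 h𝔭 he hf with hedef
  have hemb : ∀ k : 𝓞 K, k ∈ 𝔭.asIdeal ↔ ‖e (k : K)‖ < 1 := mem_asIdeal_iff_norm_embAt_lt_one 𝔭 h𝔭 he hf
  -- the continuous display (LZZ road, Manin-robust) at the embedding of the frame's prime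
  obtain ⟨Ωp₀, u, hΩp₀, hu, hcont⟩ :=
    exists_continuousDisplay_tors hL ι' W K 𝔭 κ γ Dt H ιK e P f hp2 hN hp2N hK hpw hsplit h𝔭 hι' hHN hκ hγ
      hfW hP hemb
  have hlog : Castella2018.padicLogOmega W p e P = logOmega W p e P := (R1.logOmega_eq_padicLogOmega W p e P).symm
  rw [hlog] at hcont
  -- the limit is non-zero: `P` of infinite order, `c ≠ 0`, `‖u‖ = 1`
  have hlogne : logOmega W p e P ≠ 0 := R1.logOmega_ne_zero W p e hPinf
  have hcZ : Dt.c ≠ 0 := Dt.maninConstant_ne_zero_holds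
  have hcQ : (Dt.c : ℚ_[p]) ≠ 0 := by exact_mod_cast hcZ
  have hu0 : u ≠ 0 := fun h0 ↦ by rw [h0, norm_zero] at hu; exact zero_ne_one hu
  have hc0 : u * (algebraMap ℚ_[p] ℂ_[p] (logOmega W p e P / (Dt.c : ℚ_[p]))) ^ 2 ≠ 0 :=
    mul_ne_zero hu0 (pow_ne_zero _ ((map_ne_zero _).mpr (div_ne_zero hlogne hcQ)))
  have heq := intSeries_constantCoeff_eq_of_isBDPLFunctionInt_of_continuousValues hp2 hK hκ hγ one_ne_zero
    hΩK' hΩp₀ hΩp' hcont hc0 hQ'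
  refine ⟨u, hu, ?_⟩
  rw [← heq]
  exact R1.intSeries_hasValueAt_zero p Q'


end Flat

/-! ### §2 Every `R₀`-frame: the cofactor is a UNIT of `R₀` -/

section Unr

variable {p : ℕ} [Fact p.Prime]

/-- **The value at `𝟙` of every `R₀`-frame at an additive prime, with a unit of `R₀`.** Same binders as
`intSeries_value_of_frame_tors`; for `L ∈ R₀⟦T⟧` with `IsBDPLFunction ι′ 𝔭 κ γ f Ω_K Ω_p L` (`Ω_K ≠ 0`, `Ω_p ≠ 0`):
`L(𝟙) = u·(log_{ω_E} P / c)²` with `u ∈ R₀ˣ`. Proof: §1 on `L` read in `𝓞_{ℂ_p}⟦T⟧` (`R1.isBDPLFunctionInt_map`) pins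
`[T⁰]L = u₀·x²`, `‖u₀‖ = 1`, `x = log_ω P/c ∈ ℚ_pˣ`; `[T⁰]L/x² ∈ Frac R₀` has norm one, so lies in `R₀`
(`R1.mem_unrIntegers_of_mem_fracUnr`) and is a unit (`unrIntegers.isUnit_iff_norm_eq_one`). CONDITIONAL on `hL`.
[cite: LiuZhangZhang2018, Thm 1.5.1 and Thm 1.5.3 (Duke Math. J. 167 pp. 748–749)]
[cite: SerreLocalFields1979, Ch. II §5 (the valuation ring R₀)] -/
theorem unrSeries_value_of_frame_tors
    (hL : thm151_thm153_modularCurve_heegnerVector_additive)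
    (W : WeierstrassCurve ℚ) [W.IsElliptic] [W.IsGloballyMinimal]
    (K : Type) [Field K] [NumberField K] (𝔭 : HeightOneSpectrum (𝓞 K))
    (κ : ZpExtension K p) (γ : absoluteGaloisGroup K) [Fact (κ.IsTopGenerator γ)] {N : ℕ} [NeZero N]
    (Dt : ModularParametrizationData W N) (H : HeegnerDatum N (NumberField.discr K))
    (ιK : K →+* ℂ) (P : (W.baseChange K).toAffine.Point)
    (f : CuspForm (CongruenceSubgroup.Gamma0 N) 2) (hfW : IsNewformOf W f)
    (hp2 : p ≠ 2) (hN : W.conductorNorm ℤ = N) (hp2N : p ^ 2 ∣ N) (hK : IsImaginaryQuadratic K)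
    (hpw : ¬ p ∣ NumberField.Units.torsionOrder K)
    (h𝔭 : ((p : ℕ) : 𝓞 K) ∈ 𝔭.asIdeal) (he : 𝔭.asIdeal.ramificationIdx (𝓞 ℚ) = 1)
    (hf : 𝔭.asIdeal.inertiaDeg (𝓞 ℚ) = 1)
    (hHN : SatisfiesHeegnerHypothesis N K) (hκ : κ.IsAnticyclotomic)
    (hP : WeierstrassCurve.Affine.Point.map ιK.toRatAlgHom P = heegnerPointComplex Dt H)
    (hPinf : ¬ IsOfFinAddOrder P)
    (ι' : PadicAlgCl p ≃+* ℂ)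
    (hι' : ∀ (w : InfinitePlace K) (k : 𝓞 K), k ∈ 𝔭.asIdeal ↔ ‖ι'.symm (w.embedding (k : K))‖ < 1)
    {ΩK : ℂ} {Ωp : ℂ_[p]} {L : UnrSeries p} (hΩK : ΩK ≠ 0) (hΩp : Ωp ≠ 0)
    (hLfr : IsBDPLFunction ι' 𝔭 κ γ f ΩK Ωp L) :
    ∃ u : (unrIntegers p)ˣ, L.HasValueAt 0
      (((u : unrIntegers p) : ℂ_[p]) *
        (algebraMap ℚ_[p] ℂ_[p] (logOmega W p (embAt K p 𝔭 h𝔭 he hf) P / (Dt.c : ℚ_[p]))) ^ 2) := by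
  have hQ' : R1.IsBDPLFunctionInt p ι' 𝔭 κ γ f ΩK Ωp (PowerSeries.map (R1.unrToCpInt p) L) :=
    R1.isBDPLFunctionInt_map hLfr
  obtain ⟨u₀, hu₀, hv⟩ := intSeries_value_of_frame_tors hL W K 𝔭 κ γ Dt H ιK P f hfW hp2 hN hp2N hK hpw h𝔭 he hf
    hHN hκ hP hPinf ι' hι' hΩK hΩp hQ'
  set x : ℚ_[p] := logOmega W p (embAt K p 𝔭 h𝔭 he hf) P / (Dt.c : ℚ_[p]) with hx
  have hv' : L.HasValueAt 0 (u₀ * (algebraMap ℚ_[p] ℂ_[p] x) ^ 2) :=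
    (R1.intSeries_hasValueAt_map_iff p L _ _).mp hv
  have hcoef : ((PowerSeries.constantCoeff L : unrIntegers p) : ℂ_[p]) = u₀ * (algebraMap ℚ_[p] ℂ_[p] x) ^ 2 :=
    (UnrSeries.eq_constantCoeff_of_hasValueAt_zero hv').symm
  have hlogne : logOmega W p (embAt K p 𝔭 h𝔭 he hf) P ≠ 0 := R1.logOmega_ne_zero W p _ hPinf
  have hcZ : Dt.c ≠ 0 := Dt.maninConstant_ne_zero_holds
  have hx0 : x ≠ 0 := div_ne_zero hlogne (by exact_mod_cast hcZ)
  have hx2 : x ^ 2 ≠ 0 := pow_ne_zero _ hx0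
  set y : ℂ_[p] := algebraMap ℚ_[p] ℂ_[p] (x ^ 2) with hy
  have hy0 : y ≠ 0 := (map_ne_zero_iff _ (algebraMap ℚ_[p] ℂ_[p]).injective).mpr hx2
  have hnorm : ‖((PowerSeries.constantCoeff L : unrIntegers p) : ℂ_[p])‖ = ‖y‖ := by
    rw [hcoef, norm_mul, hu₀, one_mul, hy, map_pow]
  set c₀ : ℂ_[p] := ((PowerSeries.constantCoeff L : unrIntegers p) : ℂ_[p]) with hc₀
  have hyF : y ∈ Subfield.closure (unrIntegers p : Set ℂ_[p]) := by
    rw [hy, IsScalarTower.algebraMap_apply ℚ_[p] (PadicAlgCl p) ℂ_[p] (x ^ 2)]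
    exact PadicComplexTransport.algebraMap_padic_mem_fracUnr p (x ^ 2)
  have hw : c₀ / y ∈ Subfield.closure (unrIntegers p : Set ℂ_[p]) :=
    div_mem (Subfield.subset_closure (PowerSeries.constantCoeff L).2) hyF
  have hw1 : ‖c₀ / y‖ = 1 := by
    rw [norm_div, hc₀, hnorm, div_self (norm_ne_zero_iff.mpr hy0)]
  have hwR : c₀ / y ∈ unrIntegers p := R1.mem_unrIntegers_of_mem_fracUnr hw hw1.le
  obtain ⟨u, hu⟩ := (unrIntegers.isUnit_iff_norm_eq_one ⟨c₀ / y, hwR⟩).mpr hw1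
  refine ⟨u, ?_⟩
  have hval : ((u : unrIntegers p) : ℂ_[p]) * (algebraMap ℚ_[p] ℂ_[p] x) ^ 2 = c₀ := by
    rw [hu, ← map_pow, ← hy]
    exact div_mul_cancel₀ c₀ hy0
  have h0 := L.hasValueAt_zero
  rw [← hc₀, ← hval] at h0
  exact h0

end Unr

end Summit.BirchSwinnertonDyer.BirchSwinnertonDyer.Theorems.UniversalToricDescentWaldspurgerFlat

/-! ### §3 K1's H2 `BranchBDPValueLeAt W p` at every additive prime -/

namespace Summit.BirchSwinnertonDyer.BirchSwinnertonDyer.Theorems.SchneiderFree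

open WeierstrassCurve NumberField IsDedekindDomain Field PowerSeries
  Literature.NumberTheory.EllipticCurves Literature.NumberTheory.EllipticCurves.ModularForms
  Literature.NumberTheory.EllipticCurves.LiuZhangZhang2018 Literature.NumberTheory.EllipticCurves.Rank1Residual
  Literature.NumberTheory.GaloisRepresentations
  Summit.BirchSwinnertonDyer.Rank1Residual Summit.BirchSwinnertonDyer.Rank1Residual.X11b
  Summit.BirchSwinnertonDyer.Rank1Residual.X11b.Halves

/-- **H2 — `SchneiderFree.BranchBDPValueLeAt W p` — holds at every additive prime, granted the refereed LZZ input.** For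
every `W/ℚ` globally minimal and every prime `p`: over the binders of H2 (`r_an = 1`, `Additive.N10.Locus W p` — which gives
`p ≠ 2` and additive reduction, hence `p² ∣ N` —, conductor `N`, `K` imaginary quadratic with `Odd d_K` and `p ∤ #𝓞_K^×`,
Heegner hypothesis, `L(E^{(d_K)},1) ≠ 0`, the datum's Heegner point `P` of infinite order, `(κ, γ)`, a degree-one `𝔭 ∋ p`, `ι′`
inducing `𝔭`), EVERY `R₀`-frame `L` of `Dt.f` has `L(𝟙) = u·(log_{ω_E} P / c)²` for some `u ∈ R₀` (indeed `u ∈ R₀ˣ`,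
`unrSeries_value_of_frame_tors`). Discharges the door's binders `hM2`/`hG2` of
`additiveX3RankOneLower_of_printedFacts_of_pt_of_typedHalves`. CONDITIONAL on `hL` only; H1 and H3 are NOT touched.
[cite: LiuZhangZhang2018, Thm 1.5.1 and Thm 1.5.3 (Duke Math. J. 167 pp. 748–749)]
[cite: JetchevSkinnerWan2017, §7.4.1 (arXiv:1512.06894 p. 30) (the Manin slack; shape)] -/
theorem branchBDPValueLeAt_of_lzz (hL : thm151_thm153_modularCurve_heegnerVector_additive)
    (W : WeierstrassCurve ℚ) [W.IsElliptic] [W.IsGloballyMinimal] (p : ℕ) [Fact p.Prime] :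
    BranchBDPValueLeAt W p := by
  intro N _ K _ _ Dt H ι P _ hN10 hN hK _ hpw hHN _ hP hPinf κ hκ γ _ 𝔭 h𝔭 he hf ι' hι' ΩK Ωp L hΩK hΩp hLfr
  have hp2 : p ≠ 2 := hN10.1
  have haddv : Addv W p := hN10.2.1
  have hp2N : p ^ 2 ∣ N := by
    by_contra h
    rw [← hN] at h
    rcases hasGoodReductionAtPrime_or_hasMultiplicativeReductionAtPrime_of_not_sq_dvd_conductorNorm (V := W) h
      with hg | hm
    · exact haddv.1 hg
    · exact haddv.2 hm
  obtain ⟨u, hu⟩ := UniversalToricDescentWaldspurgerFlat.unrSeries_value_of_frame_tors hL W K 𝔭 κ γ Dt H ι P Dt.f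
    Dt.isNewformOf hp2 hN hp2N hK hpw h𝔭 he hf hHN hκ hP hPinf ι' hι' hΩK hΩp hLfr
  exact ⟨(u : unrIntegers p), hu⟩

end Summit.BirchSwinnertonDyer.BirchSwinnertonDyer.Theorems.SchneiderFree

end
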